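import Mathlib
import Literature.AlgebraicGeometry.DeterminantalHypersurfaces.HeltonVinnikov
import Literature.FieldTheory.QuasiAlgClosed.Basic
import HarnessLib

/-!
# Lax conjecture / Helton–Vinnikov: the elementary reductions (proofs)

Support for the named fact `LewisParriloRamana2005_laxConjecture` (`HeltonVinnikov.lean`;
A. S. Lewis, P. A. Parrilo, M. V. Ramana, *The Lax conjecture is true*, Proc. AMS 133 (2005),
Conjecture 2 / Proposition 3 / Theorem 4). The deep input of every known proof — a symmetric
determinantal (or "spectral") representation theorem: Helton–Vinnikov 2007 Thm. 2.2 via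
Vinnikov's theta-function construction, or C. Hanselka, *Characteristic polynomials of
symmetric matrices over the univariate polynomial ring*, J. Algebra 487 (2017) 340–356
(arXiv:1610.06634), **Theorem 1** — is far outside Mathlib (Jacobians of curves, resp.
divisibility of class groups of complex affine curves + Harder–Djoković diagonalisation of
unimodular forms over `k[x]`). This file proves, sorry-free, the two elementary steps by which
Hanselka (loc. cit., §6) derives the Helton–Vinnikov theorem = Lax conjecture from his Theorem 1,
so that the named fact is reduced to that single published statement:

* `natDegree_le_one_of_isSymm_of_charpoly` — **Hanselka 2017, Cor. 6.2** (with Prop. 6.1 for the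
  degree valuation): if `M ∈ Sym_d(ℝ[x])` and the coefficient of `t^k` in `det(tI − M) ∈ ℝ[x][t]`
  has `x`-degree `≤ d − k` for every `k` (i.e. the characteristic polynomial has total degree `d`),
  then every entry of `M` has degree `≤ 1` ("`M` is linear"). Proof here (a shorter road than the
  valuation-theoretic one, same content): a Cauchy-type root bound gives
  `|λ| ≤ C · max(1,|x|)` for the eigenvalues of the real symmetric matrix `M(x)`, the spectral
  theorem bounds the entries of `M(x)` by `Σ |λ|`, and a real polynomial of linear growth has
  degree `≤ 1`.
* `laxConjecture_of_symmSpectralRepresentation` — **Hanselka 2017, Thm. 2 from Thm. 1** (§6,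
  proof of Thm. 2; = LPR2005 §3 in Hanselka's coordinates): assuming Hanselka's Theorem 1 as
  printed ("`f ∈ ℝ[x,t]` monic in `t` with `f(a,t)` real-rooted for all `a ∈ ℝ` admits
  `M ∈ Sym_n ℝ[x]` with `f = det(tI_n − M)`"), the Lax conjecture in the rendering of
  `LewisParriloRamana2005_laxConjecture` follows: dehomogenise `f(s,t) := p(t,s,1)`, take a
  symmetric spectral representation `M(s)`, which is linear `M(s) = M₀ + sM₁` by Cor. 6.2, and
  re-homogenise `p(x,y,z) = det(xI − yM₁ − zM₀)` (for `z ≠ 0` by homogeneity, at `z = 0` by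
  continuity).

* `laxConjecture_of_realZero_det`, `realZero_det_of_laxConjecture`,
  `laxConjecture_iff_realZero_det` — **LPR2005, Prop. 3 and §3 as printed**: "Theorem 4 [= the
  only-if direction of Helton–Vinnikov 2007, Thm. 2.2 for `m = 2`: a real-zero polynomial `q` on
  `ℝ²` of degree `d` with `q(0,0) = 1` is `det(I + yB + zC)`, `B, C ∈ S^d`] is equivalent to the
  Lax conjecture". Both directions are proved: dehomogenisation `q(y,z) = p(1,y,z)` (real-zero of
  degree `≤ d`, `q(0,0) = 1`; zero-padding of `B, C` to size `d`; `p = det(xI + yB + zC)` for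
  `x ≠ 0` by homogeneity and at `x = 0` by continuity) and homogenisation
  `p(x,y,z) = x^d q(y/x, z/x)` (a hyperbolic form; the Lax conjecture at `x = 1`). The link between
  the two root conditions is that `t ↦ q(tv)` is the reflection `t^d r(1/t)` of the restriction
  `r(s) = p(s, v)` (`splits_reflect`, `eval_reflect_of_ne_zero`).

* `det_pencil_hyperbolic` — the "if" direction of Conjecture 2 ("immediate", ibid.; cf. Prop. 1):
  `det(xI + yB + zC)` with `B, C` real symmetric is a hyperbolic form of degree `d` normalised at
  `e`, in the same rendering (`p(w − te) = (−1)^d det(tI − (w₀I + w₁B + w₂C))`, spectral theorem).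
  (The "if" direction of Theorem 4 as literally printed over-states the degree: for `B = C = 0`,
  `det(I + yB + zC) = 1` has degree `0`, not `d`; Helton–Vinnikov state it with degree `≤ d`. Only
  the only-if directions are used anywhere here.)

* `symmetric_pencil_of_laxConjecture`, `heltonVinnikov_of_laxConjecture` — **Hanselka 2017, Thm. 2
  for a general direction `e`** (as printed: "`F` hyperbolic with respect to `e ∈ ℝ³` ⇒ there is
  a real symmetric pencil `L = Ax + By + Cz` with `L(e) ≻ 0` and `F = det L`"), derived from the
  named fact by the linear change of variables of its printed proof (normalised form
  `F = F(e)·det L`, `L(e) = I` in every degree; printed form for `d > 0` by absorbing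
  `F(e)^{1/d}`).

So the whole printed content of LPR2005 is formalized here, and the named fact is reduced to either
of the two published deep inputs — Helton–Vinnikov's Thm. 2.2 (hypothesis `H` of
`laxConjecture_of_realZero_det`) or Hanselka's Thm. 1 (hypothesis `H` of
`laxConjecture_of_symmSpectralRepresentation`). No new definitions and no new named facts are
introduced (D-0026); the deep inputs enter only as explicit hypotheses.

## References
* [Hanselka2017] C. Hanselka, Characteristic polynomials of symmetric matrices over the
  univariate polynomial ring, J. Algebra 487 (2017) 340–356; arXiv:1610.06634: Thm. 1, Thm. 2,
  Prop. 6.1, Cor. 6.2 and the proof of Thm. 2 (§6).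
* [LewisParriloRamana2005] A. S. Lewis, P. A. Parrilo, M. V. Ramana, The Lax conjecture is true,
  Proc. AMS 133 (2005) 2495–2499; arXiv:math/0304104: Conjecture 2, Proposition 3, Theorem 4 and
  §3 (the equivalence of Theorem 4 with Conjecture 2).
* [HeltonVinnikov2006] J. W. Helton, V. Vinnikov, Linear matrix inequality representation of
  sets, CPAM 60 (2007) 654–674: Thm. 2.2.
-/

noncomputable section

open Polynomial Matrix Finset

namespace Literature.AlgebraicGeometry.DeterminantalHypersurfaces

/-! ### Elementary estimates for real polynomials -/

/-- `|p(x)| ≤ (Σᵢ |pᵢ|) · max(1,|x|)^{deg p}`. [folklore] -/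
theorem abs_eval_le_sum_abs_coeff_mul (p : ℝ[X]) (x : ℝ) :
    |p.eval x| ≤ (∑ i ∈ range (p.natDegree + 1), |p.coeff i|) * max 1 |x| ^ p.natDegree := by
  rw [eval_eq_sum_range, sum_mul]
  refine (abs_sum_le_sum_abs _ _).trans (sum_le_sum fun i hi => ?_)
  have hi' : i ≤ p.natDegree := Nat.lt_succ_iff.mp (mem_range.mp hi)
  have h1 : (1 : ℝ) ≤ max 1 |x| := le_max_left _ _
  rw [abs_mul, abs_pow]
  calc |p.coeff i| * |x| ^ i ≤ |p.coeff i| * max 1 |x| ^ i := by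
        gcongr
        exact le_max_right _ _
    _ ≤ |p.coeff i| * max 1 |x| ^ p.natDegree :=
        mul_le_mul_of_nonneg_left (pow_le_pow_right₀ h1 hi') (abs_nonneg _)

/-- A Cauchy-type root bound: if `q` is monic of degree `n` and `|q_k| ≤ B_k s^{n-k}` (`s ≥ 1`)
for `k < n`, then every real root `t` of `q` satisfies `|t| ≤ (1 + Σ_k B_k) s`. [folklore] -/
theorem abs_le_of_isRoot_of_coeff_le {q : ℝ[X]} {n : ℕ} (hq : q.Monic) (hqn : q.natDegree = n)
    {s : ℝ} (hs : 1 ≤ s) {B : ℕ → ℝ} (hB0 : ∀ k, 0 ≤ B k)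
    (hB : ∀ k < n, |q.coeff k| ≤ B k * s ^ (n - k)) {t : ℝ} (ht : q.IsRoot t) :
    |t| ≤ (1 + ∑ k ∈ range n, B k) * s := by
  by_contra hlt
  push Not at hlt
  set S := ∑ k ∈ range n, B k with hSdef
  have hS0 : 0 ≤ S := sum_nonneg fun k _ => hB0 k
  have hs0 : 0 < s := by linarith
  have hst : s ≤ |t| := by nlinarith
  have ht0 : 0 < |t| := by linarith
  have hcoef : q.coeff n = 1 := by rw [← hqn]; exact hq.coeff_natDegree
  have hroot : q.eval t = 0 := ht
  rw [eval_eq_sum_range, hqn, sum_range_succ, hcoef, one_mul] at hroot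
  have hexp : t ^ n = -∑ k ∈ range n, q.coeff k * t ^ k := by linarith
  have key : |t| ^ n ≤ S * s * |t| ^ (n - 1) := by
    calc |t| ^ n = |∑ k ∈ range n, q.coeff k * t ^ k| := by rw [← abs_pow, hexp, abs_neg]
      _ ≤ ∑ k ∈ range n, |q.coeff k * t ^ k| := abs_sum_le_sum_abs _ _
      _ ≤ ∑ k ∈ range n, B k * s * |t| ^ (n - 1) := by
          refine sum_le_sum fun k hk => ?_
          have hkn : k < n := mem_range.mp hk
          rw [abs_mul, abs_pow]
          have h2 : s ^ (n - k) * |t| ^ k ≤ s * |t| ^ (n - 1) := by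
            have hnk : n - k = (n - k - 1) + 1 := by omega
            rw [hnk, pow_succ]
            have h3 : s ^ (n - k - 1) ≤ |t| ^ (n - k - 1) := pow_le_pow_left₀ hs0.le hst _
            calc s ^ (n - k - 1) * s * |t| ^ k ≤ |t| ^ (n - k - 1) * s * |t| ^ k := by gcongr
              _ = s * (|t| ^ (n - k - 1) * |t| ^ k) := by ring
              _ = s * |t| ^ (n - 1) := by
                  rw [← pow_add]
                  congr 2
                  omega
          calc |q.coeff k| * |t| ^ k ≤ B k * s ^ (n - k) * |t| ^ k := by
                gcongr
                exact hB k hkn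
            _ = B k * (s ^ (n - k) * |t| ^ k) := by ring
            _ ≤ B k * (s * |t| ^ (n - 1)) := by
                gcongr
                exact hB0 k
            _ = B k * s * |t| ^ (n - 1) := by ring
      _ = S * s * |t| ^ (n - 1) := by rw [hSdef, sum_mul, sum_mul]
  rcases Nat.eq_zero_or_pos n with hn | hn
  · subst hn
    have hfalse : (1 : ℝ) ≤ 0 := by simpa [hSdef] using key
    linarith
  · have hsplit : |t| ^ n = |t| * |t| ^ (n - 1) := by
      rw [← pow_succ']
      congr 1
      omega
    rw [hsplit] at key
    have hpos : 0 < |t| ^ (n - 1) := pow_pos ht0 _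
    have hle : |t| ≤ S * s := le_of_mul_le_mul_right key hpos
    nlinarith

/-- A real polynomial of at most linear growth on `[1, ∞)` has degree `≤ 1`. [folklore] -/
theorem natDegree_le_one_of_abs_eval_le {g : ℝ[X]} {K : ℝ}
    (h : ∀ x : ℝ, 1 ≤ x → |g.eval x| ≤ K * x) : g.natDegree ≤ 1 := by
  by_contra hdeg
  push Not at hdeg
  have hg0 : g ≠ 0 := by
    rintro rfl
    simp at hdeg
  set P : ℝ[X] := g * g with hP
  set Q : ℝ[X] := X ^ 2 with hQ
  have hQ0 : Q ≠ 0 := pow_ne_zero _ X_ne_zero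
  have hdegQP : Q.degree < P.degree := by
    rw [hQ, hP, degree_mul, degree_eq_natDegree hg0, degree_X_pow]
    norm_cast
    omega
  have hlead : 0 ≤ P.leadingCoeff / Q.leadingCoeff := by
    rw [hP, hQ, leadingCoeff_mul, leadingCoeff_X_pow, div_one]
    exact mul_self_nonneg _
  have htend := Polynomial.div_tendsto_atTop_of_degree_gt P Q hdegQP hQ0 hlead
  obtain ⟨x₀, hx₀⟩ := Filter.eventually_atTop.mp (htend.eventually_gt_atTop (K ^ 2))
  set x : ℝ := max x₀ 1 with hx
  have hx1 : 1 ≤ x := le_max_right _ _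
  have hxpos : 0 < x := by linarith
  have hlt : K ^ 2 < eval x P / eval x Q := hx₀ x (le_max_left _ _)
  have hb : |g.eval x| ≤ K * x := h x hx1
  have hPQ : eval x P / eval x Q = (g.eval x) ^ 2 / x ^ 2 := by
    simp [hP, hQ, eval_mul, eval_X, sq]
  rw [hPQ, lt_div_iff₀ (by positivity)] at hlt
  have hsq : (g.eval x) ^ 2 ≤ (K * x) ^ 2 := by
    calc (g.eval x) ^ 2 = |g.eval x| ^ 2 := (sq_abs _).symm
      _ ≤ (K * x) ^ 2 := pow_le_pow_left₀ (abs_nonneg _) hb 2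
  nlinarith

/-! ### Entries of a real symmetric matrix versus its eigenvalues -/

/-- Every entry of a real symmetric matrix is bounded in absolute value by the sum of the
absolute values of its eigenvalues (spectral theorem: `A = U diag(λ) Uᵀ` with `|U_{ik}| ≤ 1`).
[folklore] -/
theorem abs_apply_le_sum_abs_eigenvalues {n : Type*} [Fintype n] [DecidableEq n]
    {A : Matrix n n ℝ} (hA : A.IsHermitian) (i j : n) :
    |A i j| ≤ ∑ k, |hA.eigenvalues k| := by
  set U : Matrix n n ℝ := (hA.eigenvectorUnitary : Matrix n n ℝ) with hU
  have hspec : A = U * diagonal hA.eigenvalues * star U := by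
    have h := hA.spectral_theorem
    rw [Unitary.conjStarAlgAut_apply] at h
    simpa [RCLike.ofReal_real_eq_id] using h
  have hunit : U * star U = 1 := Matrix.mem_unitaryGroup_iff.mp (hA.eigenvectorUnitary).2
  have hrow : ∀ i k, |U i k| ≤ 1 := by
    intro i k
    have h2 : (U * star U) i i = 1 := by rw [hunit]; simp
    rw [mul_apply] at h2
    have h3 : ∑ l, U i l ^ 2 = 1 := by
      simpa [star_apply, sq] using h2
    have h4 : U i k ^ 2 ≤ 1 := by
      rw [← h3]
      exact single_le_sum (f := fun l => U i l ^ 2) (fun l _ => sq_nonneg _) (mem_univ k)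
    exact (sq_le_one_iff_abs_le_one _).mp h4
  have hentry : A i j = ∑ k, U i k * hA.eigenvalues k * U j k := by
    have h0 : A i j = (U * diagonal hA.eigenvalues * star U) i j :=
      congrFun (congrFun hspec i) j
    rw [h0, mul_apply]
    refine sum_congr rfl fun k _ => ?_
    rw [mul_diagonal, star_apply, star_trivial]
  rw [hentry]
  refine (abs_sum_le_sum_abs _ _).trans (sum_le_sum fun k _ => ?_)
  rw [abs_mul, abs_mul]
  calc |U i k| * |hA.eigenvalues k| * |U j k| ≤ 1 * |hA.eigenvalues k| * 1 := by
        gcongr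
        · exact hrow i k
        · exact hrow j k
    _ = |hA.eigenvalues k| := by ring

/-! ### Hanselka 2017, Cor. 6.2: symmetric spectral representations of total degree `d` are linear -/

/-- **Hanselka 2017, Cor. 6.2** (via Prop. 6.1 for the degree valuation). Let `M ∈ Sym_d(ℝ[x])`
and let `f = det(tI_d − M) = Σ_k f_k(x) t^k` be its characteristic polynomial. If
`deg_x f_k ≤ d − k` for all `k` (i.e. `f ∈ ℝ[x,t]` has total degree `d`), then `M` is linear:
every entry of `M` has degree `≤ 1`. (Printed: "Let `M ∈ Sym_n ℝ[x]` and `f = det(tI_n − M)`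
its characteristic polynomial. If the total degree of `f` is `n`, then `M` is linear, i.e., its
entries have at most degree one.") The proof given here replaces the residue-field argument of
Prop. 6.1 by the equivalent archimedean estimate: the eigenvalues of the real symmetric matrix
`M(x)` are roots of `f(x,·)`, hence `O(|x|)`, so the entries of `M(x)` are `O(|x|)`.
[cite: Hanselka2017, Prop. 6.1 and Cor. 6.2] -/
theorem natDegree_le_one_of_isSymm_of_charpoly {d : ℕ} {M : Matrix (Fin d) (Fin d) ℝ[X]}
    (hM : M.IsSymm) (hdeg : ∀ k, (M.charpoly.coeff k).natDegree ≤ d - k) (i j : Fin d) :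
    (M i j).natDegree ≤ 1 := by
  -- constants depending only on `M.charpoly`
  set B : ℕ → ℝ := fun k =>
    ∑ l ∈ range ((M.charpoly.coeff k).natDegree + 1), |(M.charpoly.coeff k).coeff l| with hBdef
  have hB0 : ∀ k, 0 ≤ B k := fun k => sum_nonneg fun _ _ => abs_nonneg _
  set K : ℝ := (d : ℝ) * (1 + ∑ k ∈ range d, B k) with hKdef
  refine natDegree_le_one_of_abs_eval_le (K := K) fun x hx => ?_
  -- the real symmetric matrix `M(x)`
  set A : Matrix (Fin d) (Fin d) ℝ := M.map (evalRingHom x) with hAdef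
  have hAsymm : A.IsSymm := hM.map _
  have hA : A.IsHermitian := by
    change Aᴴ = A
    rw [conjTranspose_eq_transpose_of_trivial]
    exact hAsymm
  have hchar : A.charpoly = M.charpoly.map (evalRingHom x) := charpoly_map M (evalRingHom x)
  have hs : (1 : ℝ) ≤ max 1 |x| := le_max_left _ _
  -- every eigenvalue of `M(x)` is a root of `f(x, ·)`, hence `O(|x|)`
  have heig : ∀ k, |hA.eigenvalues k| ≤ (1 + ∑ k ∈ range d, B k) * max 1 |x| := by
    intro k
    refine abs_le_of_isRoot_of_coeff_le (q := A.charpoly) (charpoly_monic A) ?_ hs hB0 ?_ ?_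
    · rw [charpoly_natDegree_eq_dim, Fintype.card_fin]
    · intro l _
      rw [hchar, coeff_map, coe_evalRingHom]
      calc |eval x (M.charpoly.coeff l)|
          ≤ B l * max 1 |x| ^ (M.charpoly.coeff l).natDegree := abs_eval_le_sum_abs_coeff_mul _ _
        _ ≤ B l * max 1 |x| ^ (d - l) :=
            mul_le_mul_of_nonneg_left (pow_le_pow_right₀ hs (hdeg l)) (hB0 l)
    · rw [IsRoot.def, hA.charpoly_eq, eval_prod]
      exact prod_eq_zero (mem_univ k) (by simp)
  -- hence every entry of `M(x)` is `O(|x|)`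
  have hentry : |A i j| ≤ K * max 1 |x| := by
    calc |A i j| ≤ ∑ k, |hA.eigenvalues k| := abs_apply_le_sum_abs_eigenvalues hA i j
      _ ≤ ∑ _k : Fin d, (1 + ∑ k ∈ range d, B k) * max 1 |x| := sum_le_sum fun k _ => heig k
      _ = K * max 1 |x| := by
          rw [sum_const, card_univ, Fintype.card_fin, nsmul_eq_mul, hKdef]
          ring
  have hx' : max 1 |x| = x := by
    rw [abs_of_nonneg (by linarith), max_eq_right hx]
  have hAij : A i j = (M i j).eval x := by
    rw [hAdef, map_apply, coe_evalRingHom]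
  rw [← hAij, ← hx']
  exact hentry

/-! ### Evaluation of polynomial-valued substitutions -/

/-- Two-level version of `FieldTheory.QuasiAlgClosed.eval_aeval_eq_eval` (evaluation of a
substitution of univariate polynomials into a multivariate one) for substitutions into `ℝ[x][t]`:
first the coefficient variable `x ↦ a`, then `t ↦ s`. [folklore] -/
theorem eval_map_aeval_polynomial {σ : Type*} (φ : σ → ℝ[X][X]) (p : MvPolynomial σ ℝ)
    (a s : ℝ) :
    ((MvPolynomial.aeval φ p).map (evalRingHom a)).eval s =
      MvPolynomial.eval (fun i => ((φ i).map (evalRingHom a)).eval s) p := by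
  induction p using MvPolynomial.induction_on with
  | C c =>
      simp only [MvPolynomial.algHom_C, MvPolynomial.eval_C]
      rw [Polynomial.algebraMap_apply]
      simp
  | add p q hp hq => simp [hp, hq]
  | mul_X p i hp => simp [hp]

/-! ### Hanselka 2017, Thm. 2 (= Helton–Vinnikov = Lax conjecture) from Thm. 1 -/

/-- **Hanselka 2017, Theorem 2 from Theorem 1** (loc. cit. §6, proof of Thm. 2), in the rendering
of `LewisParriloRamana2005_laxConjecture`. The hypothesis `H` is Hanselka's **Theorem 1** as
printed: "Let `f ∈ ℝ[x,t]` be real rooted, i.e., monic in `t` and for all `a ∈ ℝ` the univariate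
polynomial `f(a,t) ∈ ℝ[t]` has only real roots. Then `f` admits a symmetric spectral
representation over `ℝ[x]`, i.e., there exists `M ∈ Sym_n ℝ[x]` such that `f = det(tI_n − M)`"
(`f : ℝ[X][X]` with outer variable `t` and coefficients in `ℝ[x]`; "only real roots" for the
monic degree-`n` polynomial `f(a,·)` is `card roots = n`; `Matrix.charpoly M = det(tI − M)`).
Given `H`, a form `p(x,y,z)` of degree `d`, hyperbolic w.r.t. `(1,0,0)` with `p(1,0,0) = 1`, is
`det(xI + yB + zC)` with `B, C` real symmetric: dehomogenise `f(s,t) := p(t,s,1)` (monic of degree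
`d` in `t`, real rooted, of total degree `d`), take `M` from `H`, which is linear
`M = M₀ + sM₁` by `natDegree_le_one_of_isSymm_of_charpoly` (Cor. 6.2), so
`p(t,s,1) = det(tI − M₀ − sM₁)`; re-homogenise for `z ≠ 0` and pass to `z = 0` by continuity.
[cite: Hanselka2017, Thm. 1, Thm. 2 and §6] [cite: LewisParriloRamana2005, Prop. 3 and §3] -/
theorem laxConjecture_of_symmSpectralRepresentation
    (H : ∀ (n : ℕ) (f : ℝ[X][X]), f.Monic → f.natDegree = n →
      (∀ a : ℝ, Multiset.card (f.map (evalRingHom a)).roots = n) →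
      ∃ M : Matrix (Fin n) (Fin n) ℝ[X], M.IsSymm ∧ M.charpoly = f) :
    LewisParriloRamana2005_laxConjecture := by
  unfold LewisParriloRamana2005_laxConjecture
  intro d p hhom hpe hhyp
  -- the dehomogenisation `f(s,t) = p(t,s,1) ∈ ℝ[s][t]`
  set φ : Fin 3 → ℝ[X][X] := ![X, C X, 1] with hφ
  set f : ℝ[X][X] := MvPolynomial.aeval φ p with hfdef
  -- degrees of the monomials of `p`
  have hmon : ∀ m ∈ p.support, m 0 + m 1 + m 2 = d := by
    intro m hm
    have h := hhom (MvPolynomial.mem_support_iff.mp hm)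
    have h' : (m.sum fun _ e => e) = d := by
      simpa only [Finsupp.weight_apply, Pi.one_apply, smul_eq_mul, mul_one] using h
    rw [Finsupp.sum_fintype _ _ (by simp)] at h'
    simpa [Fin.sum_univ_three] using h'
  -- `f` as an explicit sum over the support of `p`
  have hterm : ∀ m : Fin 3 →₀ ℕ, MvPolynomial.aeval φ (MvPolynomial.monomial m (p.coeff m)) =
      C (C (p.coeff m) * X ^ (m 1)) * X ^ (m 0) := by
    intro m
    rw [MvPolynomial.aeval_monomial, Finsupp.prod_fintype _ _ (by simp), Fin.prod_univ_three]
    simp only [hφ, Matrix.cons_val_zero, Matrix.cons_val_one, Matrix.head_cons,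
      Matrix.cons_val_two, Matrix.tail_cons, one_pow, mul_one]
    rw [Polynomial.algebraMap_apply, Polynomial.algebraMap_eq, ← C_pow, C_mul]
    ring
  have hf : f = ∑ m ∈ p.support, C (C (p.coeff m) * X ^ (m 1)) * X ^ (m 0) := by
    conv_lhs => rw [hfdef, ← p.support_sum_monomial_coeff, map_sum]
    exact sum_congr rfl fun m _ => hterm m
  have hcoeff : ∀ k, f.coeff k =
      ∑ m ∈ p.support, if k = m 0 then C (p.coeff m) * X ^ (m 1) else 0 := by
    intro k
    rw [hf, finsetSum_coeff]
    exact sum_congr rfl fun m _ => by rw [coeff_C_mul_X_pow]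
  -- total degree `d`: `deg_s (coeff of t^k) ≤ d - k`
  have hcoeffdeg : ∀ k, (f.coeff k).natDegree ≤ d - k := by
    intro k
    rw [hcoeff]
    refine natDegree_sum_le_of_forall_le _ _ fun m hm => ?_
    split_ifs with hk
    · refine (natDegree_C_mul_X_pow_le _ _).trans ?_
      have := hmon m hm
      omega
    · simp
  -- `f` is monic of degree `d` in `t`
  have hnatdeg_le : f.natDegree ≤ d := by
    rw [hf]
    refine natDegree_sum_le_of_forall_le _ _ fun m hm => ?_
    refine (natDegree_C_mul_X_pow_le _ _).trans ?_
    have := hmon m hm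
    omega
  have hsingle : ∀ m ∈ p.support, m 1 = 0 → m 2 = 0 → m = Finsupp.single 0 d := by
    intro m hm h1 h2
    have h0 : m 0 = d := by have := hmon m hm; omega
    ext i
    fin_cases i <;> simp [h0, h1, h2]
  have hpcoeff : p.coeff (Finsupp.single 0 d) = 1 := by
    rw [MvPolynomial.eval_eq'] at hpe
    rw [← hpe]
    symm
    calc ∑ m ∈ p.support, p.coeff m * ∏ i, (![1, 0, 0] : Fin 3 → ℝ) i ^ m i
        = ∑ m ∈ p.support, if m = Finsupp.single 0 d then p.coeff m else 0 := by
          refine sum_congr rfl fun m hm => ?_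
          rw [Fin.prod_univ_three]
          simp only [Matrix.cons_val_zero, Matrix.cons_val_one, Matrix.head_cons,
            Matrix.cons_val_two, Matrix.tail_cons, one_pow, one_mul]
          by_cases h1 : m 1 = 0
          · by_cases h2 : m 2 = 0
            · rw [if_pos (hsingle m hm h1 h2), h1, h2]
              simp
            · rw [if_neg, zero_pow h2, mul_zero, mul_zero]
              rintro rfl
              simp at h2
          · rw [if_neg, zero_pow h1, zero_mul, mul_zero]
            rintro rfl
            simp at h1
      _ = p.coeff (Finsupp.single 0 d) := by
          rw [sum_ite_eq']
          split_ifs with hmem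
          · rfl
          · exact (MvPolynomial.notMem_support_iff.mp hmem).symm
  have hcoeffd : f.coeff d = 1 := by
    rw [hcoeff]
    calc ∑ m ∈ p.support, (if d = m 0 then C (p.coeff m) * X ^ (m 1) else 0)
        = ∑ m ∈ p.support, if m = Finsupp.single 0 d then C (p.coeff m) else 0 := by
          refine sum_congr rfl fun m hm => ?_
          by_cases hd : d = m 0
          · have h1 : m 1 = 0 := by have := hmon m hm; omega
            have h2 : m 2 = 0 := by have := hmon m hm; omega
            rw [if_pos hd, if_pos (hsingle m hm h1 h2), h1, pow_zero, mul_one]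
          · rw [if_neg hd, if_neg]
            rintro rfl
            simp at hd
      _ = 1 := by
          rw [sum_ite_eq']
          rw [if_pos (MvPolynomial.mem_support_iff.mpr (by rw [hpcoeff]; exact one_ne_zero)),
            hpcoeff, map_one]
  have hfdeg : f.natDegree = d := by
    refine le_antisymm hnatdeg_le (le_natDegree_of_ne_zero ?_)
    rw [hcoeffd]
    exact one_ne_zero
  have hfmonic : f.Monic := by
    rw [Monic, leadingCoeff, hfdeg, hcoeffd]
  -- evaluation: `f(a, t) = p(t, a, 1)`
  have hfeval : ∀ a t : ℝ, (f.map (evalRingHom a)).eval t = MvPolynomial.eval ![t, a, 1] p := by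
    intro a t
    have hfun : (fun i => ((φ i).map (evalRingHom a)).eval t) = ![t, a, 1] := by
      funext i
      fin_cases i <;> simp [hφ]
    rw [hfdef, eval_map_aeval_polynomial, hfun]
  -- real-rootedness of `f(a, ·)` from hyperbolicity of `p` at `w = (0, a, 1)`
  have hfroots : ∀ a : ℝ, Multiset.card (f.map (evalRingHom a)).roots = d := by
    intro a
    set fa := f.map (evalRingHom a) with hfa
    have hfamonic : fa.Monic := hfmonic.map _
    have hfadeg : fa.natDegree = d := by rw [hfa, hfmonic.natDegree_map, hfdeg]
    set q : ℝ[X] := MvPolynomial.aeval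
      (fun i => C ((![0, a, 1] : Fin 3 → ℝ) i) - C ((![1, 0, 0] : Fin 3 → ℝ) i) * X) p with hqdef
    have hq : Multiset.card q.roots = d := hhyp ![0, a, 1]
    have hqfa : q = fa.comp (-X) := by
      refine Polynomial.funext fun t => ?_
      have hfun : (fun i => (C ((![0, a, 1] : Fin 3 → ℝ) i) -
          C ((![1, 0, 0] : Fin 3 → ℝ) i) * X).eval t) = ![-t, a, 1] := by
        funext i
        fin_cases i <;> simp
      rw [hqdef, FieldTheory.QuasiAlgClosed.eval_aeval_eq_eval, eval_comp, eval_neg, eval_X, hfa,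
        hfeval, hfun]
    have hqdeg : q.natDegree = d := by
      rw [hqfa, natDegree_comp, hfadeg]
      simp
    have hqsplit : q.Splits := splits_iff_card_roots.mpr (by rw [hq, hqdeg])
    have hfaq : fa = q.comp (-X) := by
      rw [hqfa, comp_assoc]
      simp
    have hfasplit : fa.Splits := by
      rw [hfaq]
      exact hqsplit.comp_neg_X
    rw [splits_iff_card_roots.mp hfasplit, hfadeg]
  -- Hanselka's Theorem 1 gives a symmetric spectral representation, linear by Cor. 6.2
  obtain ⟨M, hMsymm, hMchar⟩ := H d f hfmonic hfdeg hfroots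
  have hlin : ∀ i j, (M i j).natDegree ≤ 1 :=
    natDegree_le_one_of_isSymm_of_charpoly hMsymm (fun k => by rw [hMchar]; exact hcoeffdeg k)
  set B : Matrix (Fin d) (Fin d) ℝ := -M.map (fun q => q.coeff 1) with hBdef
  set C' : Matrix (Fin d) (Fin d) ℝ := -M.map (fun q => q.coeff 0) with hCdef
  have hBsymm : B.IsSymm := (hMsymm.map _).neg
  have hCsymm : C'.IsSymm := (hMsymm.map _).neg
  -- `p(t, a, 1) = det(tI + aB + C')`
  have hdet1 : ∀ t a : ℝ, MvPolynomial.eval ![t, a, 1] p =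
      (t • (1 : Matrix (Fin d) (Fin d) ℝ) + a • B + (1 : ℝ) • C').det := by
    intro t a
    set A : Matrix (Fin d) (Fin d) ℝ := M.map (evalRingHom a) with hAdef
    have hA : A = -(a • B + C') := by
      ext i j
      have hij := eq_X_add_C_of_natDegree_le_one (hlin i j)
      simp only [hAdef, hBdef, hCdef, Matrix.map_apply, coe_evalRingHom, Matrix.neg_apply,
        Matrix.add_apply, Matrix.smul_apply, smul_eq_mul]
      conv_lhs => rw [hij]
      simp only [eval_add, eval_mul, eval_C, eval_X]
      ring
    have hchar : A.charpoly = f.map (evalRingHom a) := by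
      rw [hAdef, charpoly_map, hMchar]
    have h := eval_charpoly A t
    rw [hchar, hfeval] at h
    rw [h, hA, one_smul, scalar_apply, ← smul_one_eq_diagonal]
    congr 1
    abel
  refine ⟨B, C', hBsymm, hCsymm, fun x y z => ?_⟩
  -- re-homogenise for `z ≠ 0`
  have key : ∀ z : ℝ, z ≠ 0 →
      MvPolynomial.eval ![x, y, z] p = (x • (1 : Matrix (Fin d) (Fin d) ℝ) + y • B + z • C').det := by
    intro z hz
    have hzx : z * (x / z) = x := by field_simp
    have hzy : z * (y / z) = y := by field_simp
    have h1 : (![x, y, z] : Fin 3 → ℝ) = z • ![x / z, y / z, 1] := by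
      funext i
      fin_cases i <;> simp [hzx, hzy]
    have h2 : x • (1 : Matrix (Fin d) (Fin d) ℝ) + y • B + z • C' =
        z • ((x / z) • (1 : Matrix (Fin d) (Fin d) ℝ) + (y / z) • B + (1 : ℝ) • C') := by
      rw [smul_add, smul_add, smul_smul, smul_smul, smul_smul, hzx, hzy, mul_one]
    rw [h1, hhom.eval_smul_eq, hdet1, h2, det_smul, Fintype.card_fin]
  -- and pass to `z = 0` by continuity
  have hc1 : Continuous fun z : ℝ => MvPolynomial.eval ![x, y, z] p := by
    refine (MvPolynomial.continuous_eval p).comp ?_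
    refine continuous_pi fun i => ?_
    fin_cases i <;> simp <;> first | exact continuous_const | exact continuous_id
  have hc2 : Continuous fun z : ℝ =>
      (x • (1 : Matrix (Fin d) (Fin d) ℝ) + y • B + z • C').det :=
    (continuous_const.add (continuous_id.smul continuous_const)).matrix_det
  exact congrFun (Continuous.ext_on (dense_compl_singleton (0 : ℝ)) hc1 hc2
    (fun z hz => key z hz)) z

/-! ### Reflection of split polynomials -/

/-- The reflection `t^N f(1/t)` of a split polynomial is split. [folklore] -/
theorem splits_reflect {K : Type*} [Field K] {f : K[X]} (hf : f.Splits) :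
    ∀ N, f.natDegree ≤ N → (f.reflect N).Splits := by
  induction hf using Submonoid.closure_induction with
  | mem g hg =>
      intro N hN
      rcases hg with ⟨a, rfl⟩ | ⟨a, rfl⟩
      · rw [reflect_C]
        exact Splits.C_mul_X_pow a N
      · have h1 : (X + C a : K[X]).natDegree = 1 := natDegree_X_add_C a
        rw [h1] at hN
        obtain ⟨M, rfl⟩ : ∃ M, N = M + 1 := ⟨N - 1, by omega⟩
        have hrefl : (X + C a : K[X]).reflect (M + 1) = X ^ M * (C a * X + C 1) := by
          rw [reflect_add, reflect_C, ← pow_one (X : K[X]), reflect_monomial, revAt_le hN, pow_one,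
            Nat.add_sub_cancel, map_one]
          ring
        rw [hrefl]
        exact (Splits.X_pow _).mul (Splits.of_natDegree_le_one natDegree_linear_le)
  | one => intro N _; rw [reflect_one]; exact Splits.X_pow N
  | mul f g hf hg ihf ihg =>
      intro N hN
      by_cases hf0 : f = 0
      · subst hf0; simp
      by_cases hg0 : g = 0
      · subst hg0; simp
      have hdeg : (f * g).natDegree = f.natDegree + g.natDegree := natDegree_mul hf0 hg0
      have hsplit : N = f.natDegree + (N - f.natDegree) := by omega
      rw [hsplit, reflect_mul f g le_rfl (by omega)]
      exact (ihf _ le_rfl).mul (ihg _ (by omega))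

/-- Evaluation of a reflection away from `0`: `(reflect N f)(t) = t^N f(1/t)`. [folklore] -/
theorem eval_reflect_of_ne_zero {K : Type*} [Field K] {f : K[X]} {N : ℕ} (hf : f.natDegree ≤ N)
    {t : K} (ht : t ≠ 0) : (f.reflect N).eval t = t ^ N * f.eval t⁻¹ := by
  haveI : Invertible t⁻¹ := invertibleOfNonzero (inv_ne_zero ht)
  have h := eval₂_reflect_mul_pow (RingHom.id K) t⁻¹ N f hf
  rw [invOf_eq_inv, inv_inv] at h
  change (f.reflect N).eval t * t⁻¹ ^ N = f.eval t⁻¹ at h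
  have htN : t ^ N ≠ 0 := pow_ne_zero _ ht
  calc (f.reflect N).eval t = (f.reflect N).eval t * t⁻¹ ^ N * t ^ N := by
        rw [inv_pow, mul_assoc, inv_mul_cancel₀ htN, mul_one]
    _ = t ^ N * f.eval t⁻¹ := by rw [h, mul_comm]

/-- Substituting multivariate polynomials and then evaluating. [folklore] -/
theorem eval_aeval_mvPolynomial {σ τ : Type*} (ψ : σ → MvPolynomial τ ℝ) (p : MvPolynomial σ ℝ)
    (v : τ → ℝ) :
    MvPolynomial.eval v (MvPolynomial.aeval ψ p) =
      MvPolynomial.eval (fun i => MvPolynomial.eval v (ψ i)) p := by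
  rw [MvPolynomial.aeval_eq_bind₁]
  change MvPolynomial.eval₂Hom (RingHom.id ℝ) v (MvPolynomial.bind₁ ψ p) = _
  rw [MvPolynomial.eval₂Hom_bind₁]
  rfl

/-- The univariate restriction `t ↦ q(t v)` has degree at most the total degree of `q`.
[folklore] -/
theorem natDegree_aeval_C_mul_X_le {σ : Type*} (v : σ → ℝ) (q : MvPolynomial σ ℝ) :
    (MvPolynomial.aeval (fun i => C (v i) * X) q).natDegree ≤ q.totalDegree := by
  classical
  conv_lhs => rw [← q.support_sum_monomial_coeff, map_sum]
  refine natDegree_sum_le_of_forall_le _ _ fun m hm => ?_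
  rw [MvPolynomial.aeval_monomial]
  refine (natDegree_mul_le).trans ?_
  rw [Polynomial.algebraMap_eq, natDegree_C, zero_add, Finsupp.prod]
  refine (natDegree_prod_le _ _).trans (le_trans ?_ (MvPolynomial.le_totalDegree hm))
  simp only [Finsupp.sum]
  refine Finset.sum_le_sum fun i _ => ?_
  refine natDegree_pow_le.trans ?_
  calc m i * (C (v i) * X).natDegree ≤ m i * 1 :=
        Nat.mul_le_mul_left _ ((natDegree_C_mul_le _ _).trans natDegree_X_le)
    _ = m i := mul_one _

/-! ### Ternary forms normalised at `e = (1,0,0)`: the monomial `x^d` -/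

/-- In a ternary form of degree `d`, a monomial without `y` and `z` is `x^d`. [folklore] -/
theorem eq_single_of_mem_support {d : ℕ} {p : MvPolynomial (Fin 3) ℝ} (hhom : p.IsHomogeneous d)
    {m : Fin 3 →₀ ℕ} (hm : m ∈ p.support) (h1 : m 1 = 0) (h2 : m 2 = 0) :
    m = Finsupp.single 0 d := by
  have h := hhom (MvPolynomial.mem_support_iff.mp hm)
  have h' : (m.sum fun _ e => e) = d := by
    simpa only [Finsupp.weight_apply, Pi.one_apply, smul_eq_mul, mul_one] using h
  rw [Finsupp.sum_fintype _ _ (by simp)] at h'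
  have h0 : m 0 = d := by simpa [Fin.sum_univ_three, h1, h2] using h'
  ext i
  fin_cases i <;> simp [h0, h1, h2]

/-- Degrees of the monomials of a ternary form of degree `d`. [folklore] -/
theorem monomial_degree_eq {d : ℕ} {p : MvPolynomial (Fin 3) ℝ} (hhom : p.IsHomogeneous d)
    {m : Fin 3 →₀ ℕ} (hm : m ∈ p.support) : m 0 + m 1 + m 2 = d := by
  have h := hhom (MvPolynomial.mem_support_iff.mp hm)
  have h' : (m.sum fun _ e => e) = d := by
    simpa only [Finsupp.weight_apply, Pi.one_apply, smul_eq_mul, mul_one] using h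
  rw [Finsupp.sum_fintype _ _ (by simp)] at h'
  simpa [Fin.sum_univ_three] using h'

/-- For a ternary form `p` of degree `d`, `p(1,0,0)` is the coefficient of `x^d`; so the
normalisation `p(1,0,0) = 1` means that this coefficient is `1`. [folklore] -/
theorem coeff_single_eq_one {d : ℕ} {p : MvPolynomial (Fin 3) ℝ} (hhom : p.IsHomogeneous d)
    (hpe : MvPolynomial.eval ![1, 0, 0] p = 1) : p.coeff (Finsupp.single 0 d) = 1 := by
  rw [MvPolynomial.eval_eq'] at hpe
  rw [← hpe]
  symm
  calc ∑ m ∈ p.support, p.coeff m * ∏ i, (![1, 0, 0] : Fin 3 → ℝ) i ^ m i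
      = ∑ m ∈ p.support, if m = Finsupp.single 0 d then p.coeff m else 0 := by
        refine sum_congr rfl fun m hm => ?_
        rw [Fin.prod_univ_three]
        simp only [Matrix.cons_val_zero, Matrix.cons_val_one, Matrix.head_cons,
          Matrix.cons_val_two, Matrix.tail_cons, one_pow, one_mul]
        by_cases h1 : m 1 = 0
        · by_cases h2 : m 2 = 0
          · rw [if_pos (eq_single_of_mem_support hhom hm h1 h2), h1, h2]
            simp
          · rw [if_neg, zero_pow h2, mul_zero, mul_zero]
            rintro rfl
            simp at h2
        · rw [if_neg, zero_pow h1, zero_mul, mul_zero]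
          rintro rfl
          simp at h1
    _ = p.coeff (Finsupp.single 0 d) := by
        rw [sum_ite_eq']
        split_ifs with hmem
        · rfl
        · exact (MvPolynomial.notMem_support_iff.mp hmem).symm

/-! ### Restriction of a normalised ternary form to a line parallel to `e = (1,0,0)` -/

/-- For a ternary form `p` of degree `d` with `p(1,0,0) = 1`, the restriction `s ↦ p(s, b, c)` is a
monic polynomial of degree `d`. [folklore] -/
theorem monic_aeval_X_C_C {d : ℕ} {p : MvPolynomial (Fin 3) ℝ} (hhom : p.IsHomogeneous d)
    (hpe : MvPolynomial.eval ![1, 0, 0] p = 1) (b c : ℝ) :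
    (MvPolynomial.aeval (![X, C b, C c] : Fin 3 → ℝ[X]) p).Monic ∧
      (MvPolynomial.aeval (![X, C b, C c] : Fin 3 → ℝ[X]) p).natDegree = d := by
  classical
  set r := MvPolynomial.aeval (![X, C b, C c] : Fin 3 → ℝ[X]) p with hrdef
  have hterm : ∀ m : Fin 3 →₀ ℕ,
      MvPolynomial.aeval (![X, C b, C c] : Fin 3 → ℝ[X]) (MvPolynomial.monomial m (p.coeff m)) =
        C (p.coeff m * b ^ (m 1) * c ^ (m 2)) * X ^ (m 0) := by
    intro m
    rw [MvPolynomial.aeval_monomial, Finsupp.prod_fintype _ _ (by simp), Fin.prod_univ_three]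
    simp only [Matrix.cons_val_zero, Matrix.cons_val_one, Matrix.head_cons, Matrix.cons_val_two,
      Matrix.tail_cons, Polynomial.algebraMap_eq, map_mul, map_pow]
    ring
  have hr : r = ∑ m ∈ p.support, C (p.coeff m * b ^ (m 1) * c ^ (m 2)) * X ^ (m 0) := by
    conv_lhs => rw [hrdef, ← p.support_sum_monomial_coeff, map_sum]
    exact sum_congr rfl fun m _ => hterm m
  have hdeg_le : r.natDegree ≤ d := by
    rw [hr]
    refine natDegree_sum_le_of_forall_le _ _ fun m hm => ?_
    refine (natDegree_C_mul_X_pow_le _ _).trans ?_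
    have := monomial_degree_eq hhom hm
    omega
  have hcoeff : r.coeff d = 1 := by
    rw [hr, finsetSum_coeff]
    calc ∑ m ∈ p.support, (C (p.coeff m * b ^ (m 1) * c ^ (m 2)) * X ^ (m 0)).coeff d
        = ∑ m ∈ p.support, if m = Finsupp.single 0 d then p.coeff m else 0 := by
          refine sum_congr rfl fun m hm => ?_
          rw [coeff_C_mul_X_pow]
          by_cases hd : d = m 0
          · have h1 : m 1 = 0 := by have := monomial_degree_eq hhom hm; omega
            have h2 : m 2 = 0 := by have := monomial_degree_eq hhom hm; omega
            rw [if_pos hd, if_pos (eq_single_of_mem_support hhom hm h1 h2), h1, h2]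
            simp
          · rw [if_neg hd, if_neg]
            rintro rfl
            simp at hd
      _ = 1 := by
          rw [sum_ite_eq', if_pos, coeff_single_eq_one hhom hpe]
          exact MvPolynomial.mem_support_iff.mpr (by rw [coeff_single_eq_one hhom hpe]; exact one_ne_zero)
  have hdeg : r.natDegree = d :=
    le_antisymm hdeg_le (le_natDegree_of_ne_zero (by rw [hcoeff]; exact one_ne_zero))
  exact ⟨by rw [Monic, leadingCoeff, hdeg, hcoeff], hdeg⟩

/-- `s ↦ p(s, b, c)` evaluates as expected. [folklore] -/
theorem eval_aeval_X_C_C (p : MvPolynomial (Fin 3) ℝ) (b c s : ℝ) :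
    (MvPolynomial.aeval (![X, C b, C c] : Fin 3 → ℝ[X]) p).eval s = MvPolynomial.eval ![s, b, c] p := by
  have hfun : (fun i => ((![X, C b, C c] : Fin 3 → ℝ[X]) i).eval s) = ![s, b, c] := by
    funext i
    fin_cases i <;> simp
  rw [FieldTheory.QuasiAlgClosed.eval_aeval_eq_eval, hfun]

/-- Hyperbolicity of a normalised ternary form `p` with respect to `e = (1,0,0)`, in the rendering
of `LewisParriloRamana2005_laxConjecture`, says that every restriction `s ↦ p(s, b, c)` splits over
`ℝ`. [cite: LewisParriloRamana2005, §1 (definition of hyperbolicity)] -/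
theorem splits_aeval_X_C_C {d : ℕ} {p : MvPolynomial (Fin 3) ℝ} (hhom : p.IsHomogeneous d)
    (hpe : MvPolynomial.eval ![1, 0, 0] p = 1)
    (hhyp : ∀ w : Fin 3 → ℝ, Multiset.card (MvPolynomial.aeval
        (fun i => Polynomial.C (w i) - Polynomial.C ((![1, 0, 0] : Fin 3 → ℝ) i) * Polynomial.X)
        p).roots = d) (b c : ℝ) :
    (MvPolynomial.aeval (![X, C b, C c] : Fin 3 → ℝ[X]) p).Splits := by
  set r := MvPolynomial.aeval (![X, C b, C c] : Fin 3 → ℝ[X]) p with hrdef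
  set q : ℝ[X] := MvPolynomial.aeval
    (fun i => C ((![0, b, c] : Fin 3 → ℝ) i) - C ((![1, 0, 0] : Fin 3 → ℝ) i) * X) p with hqdef
  have hq : Multiset.card q.roots = d := hhyp ![0, b, c]
  have hqr : q = r.comp (-X) := by
    refine Polynomial.funext fun t => ?_
    have hfun : (fun i => (C ((![0, b, c] : Fin 3 → ℝ) i) -
        C ((![1, 0, 0] : Fin 3 → ℝ) i) * X).eval t) = ![-t, b, c] := by
      funext i
      fin_cases i <;> simp
    rw [hqdef, FieldTheory.QuasiAlgClosed.eval_aeval_eq_eval, eval_comp, eval_neg, eval_X, hrdef,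
      eval_aeval_X_C_C, hfun]
  have hrdeg : r.natDegree = d := (monic_aeval_X_C_C hhom hpe b c).2
  have hqdeg : q.natDegree = d := by
    rw [hqr, natDegree_comp, hrdeg]
    simp
  have hqsplit : q.Splits := splits_iff_card_roots.mpr (by rw [hq, hqdeg])
  have hrq : r = q.comp (-X) := by
    rw [hqr, comp_assoc]
    simp
  rw [hrq]
  exact hqsplit.comp_neg_X

/-! ### LPR2005, Prop. 3 and §3: the Lax conjecture from Helton–Vinnikov's Theorem 2.2 -/

/-- **Lewis–Parrilo–Ramana 2005, §3: "Theorem 4 ⇒ the Lax conjecture"** (with the first half of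
Prop. 3). The hypothesis `H` is **Theorem 4** of loc. cit. = Helton–Vinnikov 2007, Thm. 2.2 for
`m = 2`, only-if direction, as printed: "A polynomial `q` on `ℝ²` is a real zero polynomial of
degree `d` and satisfies `q(0,0) = 1` [only if] there exist matrices `B, C ∈ S^d` such that
`q(y,z) = det(I + yB + zC)`", where (ibid.) "`q` is a *real zero polynomial* if, for all
`(y,z) ∈ ℝ²`, the univariate polynomial `t ↦ q(ty,tz)` has all real roots" (rendered, for the
non-zero polynomial `t ↦ q(tv)` — it takes the value `q(0,0) = 1` at `0` — as
`card roots = natDegree`; the degree of `q` is its total degree). Proof as printed: `q(y,z) :=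
p(1,y,z)` is a real zero polynomial of degree `d' ≤ d` with `q(0,0) = 1` (Prop. 3: a root `μ` of
`t ↦ q(tv)` gives the root `−1/μ` of `t ↦ p((0,v) − te)`; here: `t ↦ q(tv)` is the reflection of
the split polynomial `s ↦ p(s, v)`), `H` gives `B', C' ∈ S^{d'}`, padded by zero blocks to
`B, C ∈ S^d`, and `p(x,y,z) = x^d q(y/x, z/x) = det(xI + yB + zC)` for `x ≠ 0`, hence everywhere.
[cite: LewisParriloRamana2005, Prop. 3 and §3 (proof that Theorem 4 implies Conjecture 2)]
[cite: HeltonVinnikov2006, Thm. 2.2] -/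
theorem laxConjecture_of_realZero_det
    (H : ∀ (d : ℕ) (q : MvPolynomial (Fin 2) ℝ),
      (∀ v : Fin 2 → ℝ, Multiset.card (MvPolynomial.aeval (fun i => C (v i) * X) q).roots =
        (MvPolynomial.aeval (fun i => C (v i) * X) q).natDegree) →
      q.totalDegree = d → MvPolynomial.eval ![0, 0] q = 1 →
      ∃ B C : Matrix (Fin d) (Fin d) ℝ, B.IsSymm ∧ C.IsSymm ∧
        ∀ y z : ℝ, MvPolynomial.eval ![y, z] q =
          ((1 : Matrix (Fin d) (Fin d) ℝ) + y • B + z • C).det) :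
    LewisParriloRamana2005_laxConjecture := by
  unfold LewisParriloRamana2005_laxConjecture
  intro d p hhom hpe hhyp
  classical
  -- Prop. 3, first half: the dehomogenisation `q(y,z) = p(1,y,z)` …
  set ψ : Fin 3 → MvPolynomial (Fin 2) ℝ := ![1, MvPolynomial.X 0, MvPolynomial.X 1] with hψ
  set q : MvPolynomial (Fin 2) ℝ := MvPolynomial.aeval ψ p with hqdef
  have hqeval : ∀ y z : ℝ, MvPolynomial.eval ![y, z] q = MvPolynomial.eval ![1, y, z] p := by
    intro y z
    have hfun : (fun i => MvPolynomial.eval ![y, z] (ψ i)) = ![1, y, z] := by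
      funext i
      fin_cases i <;> simp [hψ]
    rw [hqdef, eval_aeval_mvPolynomial, hfun]
  have hq0 : MvPolynomial.eval ![0, 0] q = 1 := by rw [hqeval]; exact hpe
  -- … has degree `≤ d` …
  have hqdeg : q.totalDegree ≤ d := by
    have hq : q = ∑ m ∈ p.support, MvPolynomial.C (p.coeff m) *
        (MvPolynomial.X 0 ^ (m 1) * MvPolynomial.X 1 ^ (m 2)) := by
      conv_lhs => rw [hqdef, ← p.support_sum_monomial_coeff, map_sum]
      refine sum_congr rfl fun m _ => ?_
      rw [MvPolynomial.aeval_monomial, Finsupp.prod_fintype _ _ (by simp), Fin.prod_univ_three]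
      simp [hψ, MvPolynomial.algebraMap_eq]
    rw [hq]
    refine (MvPolynomial.totalDegree_finsetSum _ _).trans (Finset.sup_le fun m hm => ?_)
    refine (MvPolynomial.totalDegree_mul _ _).trans ?_
    rw [MvPolynomial.totalDegree_C, zero_add]
    refine (MvPolynomial.totalDegree_mul _ _).trans ?_
    refine (add_le_add (MvPolynomial.totalDegree_pow _ _)
      (MvPolynomial.totalDegree_pow _ _)).trans ?_
    rw [MvPolynomial.totalDegree_X, MvPolynomial.totalDegree_X, mul_one, mul_one]
    have := monomial_degree_eq hhom hm
    omega
  -- … and is a real-zero polynomial: `t ↦ q(tv)` is the reflection of `s ↦ p(s, v)`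
  have hRZ : ∀ v : Fin 2 → ℝ, Multiset.card (MvPolynomial.aeval (fun i => C (v i) * X) q).roots =
      (MvPolynomial.aeval (fun i => C (v i) * X) q).natDegree := by
    intro v
    set Q := MvPolynomial.aeval (fun i => C (v i) * X) q with hQdef
    obtain ⟨_, hrdeg⟩ := monic_aeval_X_C_C hhom hpe (v 0) (v 1)
    have hrsplit := splits_aeval_X_C_C hhom hpe hhyp (v 0) (v 1)
    have hQeval : ∀ t, Q.eval t = MvPolynomial.eval ![1, v 0 * t, v 1 * t] p := by
      intro t
      have hfun : (fun i => (C (v i) * X).eval t) = ![v 0 * t, v 1 * t] := by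
        funext i
        fin_cases i <;> simp
      rw [hQdef, FieldTheory.QuasiAlgClosed.eval_aeval_eq_eval, hfun, hqeval]
    have hQr : Q = (MvPolynomial.aeval (![X, C (v 0), C (v 1)] : Fin 3 → ℝ[X]) p).reflect d := by
      apply Polynomial.eq_of_infinite_eval_eq
      apply Set.Infinite.mono (s := {t : ℝ | t ≠ 0})
      · intro t ht
        simp only [Set.mem_setOf_eq] at ht ⊢
        rw [hQeval, eval_reflect_of_ne_zero hrdeg.le ht, eval_aeval_X_C_C]
        have h1 : (![1, v 0 * t, v 1 * t] : Fin 3 → ℝ) = t • ![t⁻¹, v 0, v 1] := by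
          funext i
          fin_cases i
          · simp [ht]
          · simp [mul_comm]
          · simp [mul_comm]
        rw [h1, hhom.eval_smul_eq]
      · exact (Set.finite_singleton (0 : ℝ)).infinite_compl
    have hQsplit : Q.Splits := by
      rw [hQr]
      exact splits_reflect hrsplit d hrdeg.le
    exact splits_iff_card_roots.mp hQsplit
  -- Theorem 4 (Helton–Vinnikov) for `q`, in size `d' = deg q ≤ d`
  obtain ⟨d', hd'⟩ : ∃ d', q.totalDegree = d' := ⟨_, rfl⟩
  rw [hd'] at hqdeg
  obtain ⟨B', C', hB', hC', hdet'⟩ := H d' q hRZ hd' hq0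
  -- pad with zero blocks to size `d`
  obtain ⟨k, hk⟩ : ∃ k, d' + k = d := ⟨d - d', by omega⟩
  set e : Fin d' ⊕ Fin k ≃ Fin d := finSumFinEquiv.trans (finCongr hk) with he
  set B : Matrix (Fin d) (Fin d) ℝ :=
    (Matrix.fromBlocks B' 0 0 (0 : Matrix (Fin k) (Fin k) ℝ)).submatrix e.symm e.symm with hBdef
  set C'' : Matrix (Fin d) (Fin d) ℝ :=
    (Matrix.fromBlocks C' 0 0 (0 : Matrix (Fin k) (Fin k) ℝ)).submatrix e.symm e.symm with hCdef
  have hzero : (0 : Matrix (Fin k) (Fin k) ℝ).IsSymm := Matrix.transpose_zero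
  have hBsymm : B.IsSymm := by
    rw [hBdef]
    exact (hB'.fromBlocks Matrix.transpose_zero hzero).submatrix _
  have hCsymm : C''.IsSymm := by
    rw [hCdef]
    exact (hC'.fromBlocks Matrix.transpose_zero hzero).submatrix _
  have hsm : ∀ (r : ℝ) (A : Matrix (Fin d' ⊕ Fin k) (Fin d' ⊕ Fin k) ℝ),
      r • A.submatrix e.symm e.symm = (r • A).submatrix e.symm e.symm := by
    intro r A
    rw [Matrix.submatrix_smul]
    rfl
  have had : ∀ (A₁ A₂ : Matrix (Fin d' ⊕ Fin k) (Fin d' ⊕ Fin k) ℝ),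
      A₁.submatrix e.symm e.symm + A₂.submatrix e.symm e.symm = (A₁ + A₂).submatrix e.symm e.symm := by
    intro A₁ A₂
    rw [Matrix.submatrix_add]
    rfl
  have hpencil : ∀ x y z : ℝ, x • (1 : Matrix (Fin d) (Fin d) ℝ) + y • B + z • C'' =
      (Matrix.fromBlocks (x • (1 : Matrix (Fin d') (Fin d') ℝ) + y • B' + z • C') 0 0
        (x • (1 : Matrix (Fin k) (Fin k) ℝ))).submatrix e.symm e.symm := by
    intro x y z
    have h1 : (1 : Matrix (Fin d) (Fin d) ℝ) = (Matrix.fromBlocks (1 : Matrix (Fin d') (Fin d') ℝ)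
        0 0 (1 : Matrix (Fin k) (Fin k) ℝ)).submatrix e.symm e.symm := by
      rw [Matrix.fromBlocks_one, Matrix.submatrix_one_equiv]
    rw [h1, hBdef, hCdef, hsm, hsm, hsm, had, had, Matrix.fromBlocks_smul, Matrix.fromBlocks_smul,
      Matrix.fromBlocks_smul, Matrix.fromBlocks_add, Matrix.fromBlocks_add]
    simp only [smul_zero, add_zero]
  have hdetpad : ∀ x y z : ℝ, (x • (1 : Matrix (Fin d) (Fin d) ℝ) + y • B + z • C'').det =
      (x • (1 : Matrix (Fin d') (Fin d') ℝ) + y • B' + z • C').det * x ^ k := by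
    intro x y z
    rw [hpencil, Matrix.det_submatrix_equiv_self, Matrix.det_fromBlocks_zero₂₁, det_smul, det_one,
      mul_one, Fintype.card_fin]
  refine ⟨B, C'', hBsymm, hCsymm, fun x y z => ?_⟩
  -- `p(x,y,z) = x^d q(y/x, z/x) = det(xI + yB + zC)` for `x ≠ 0` …
  have key : ∀ x : ℝ, x ≠ 0 → MvPolynomial.eval ![x, y, z] p =
      (x • (1 : Matrix (Fin d) (Fin d) ℝ) + y • B + z • C'').det := by
    intro x hx
    have hxy : x * (y / x) = y := by field_simp
    have hxz : x * (z / x) = z := by field_simp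
    have h1 : (![x, y, z] : Fin 3 → ℝ) = x • ![1, y / x, z / x] := by
      funext i
      fin_cases i <;> simp [hxy, hxz]
    have h2 : x • (1 : Matrix (Fin d') (Fin d') ℝ) + y • B' + z • C' =
        x • ((1 : Matrix (Fin d') (Fin d') ℝ) + (y / x) • B' + (z / x) • C') := by
      rw [smul_add, smul_add, smul_smul, smul_smul, hxy, hxz]
    rw [h1, hhom.eval_smul_eq, ← hqeval, hdet', hdetpad, h2, det_smul, Fintype.card_fin, ← hk]
    ring
  -- … and at `x = 0` by continuity
  have hc1 : Continuous fun x : ℝ => MvPolynomial.eval ![x, y, z] p := by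
    refine (MvPolynomial.continuous_eval p).comp ?_
    refine continuous_pi fun i => ?_
    fin_cases i <;> simp <;> first | exact continuous_const | exact continuous_id
  have hc2 : Continuous fun x : ℝ =>
      (x • (1 : Matrix (Fin d) (Fin d) ℝ) + y • B + z • C'').det :=
    (((continuous_id.smul continuous_const).add continuous_const).add continuous_const).matrix_det
  exact congrFun (Continuous.ext_on (dense_compl_singleton (0 : ℝ)) hc1 hc2
    (fun x hx => key x hx)) x

/-- **Lewis–Parrilo–Ramana 2005, §3: "Conversely, the Lax conjecture implies Theorem 4"** (with
the second half of Prop. 3): from `LewisParriloRamana2005_laxConjecture`, every real-zero polynomial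
`q` on `ℝ²` of (total) degree `d` with `q(0,0) = 1` is `q(y,z) = det(I + yB + zC)` with `B, C`
real symmetric `d × d` (Helton–Vinnikov 2007, Thm. 2.2, `m = 2`, only-if direction; renderings as
in `laxConjecture_of_realZero_det`). Proof as printed: the homogenisation
`p(x,y,z) := x^d q(y/x, z/x)` is a form of degree `d` with `p(1,0,0) = q(0,0) = 1`, hyperbolic
with respect to `e = (1,0,0)` (Prop. 3: if `p(μ,y,z) = 0` then `μ = 0` or `q((y,z)/μ) = 0`, so
`μ` is real; here: `t ↦ p(w − te)` is, up to the affine substitution `s = w₀ − t`, the reflection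
of the split polynomial `t ↦ q(t(w₁,w₂))`), and the Lax conjecture at `x = 1` gives
`q(y,z) = p(1,y,z) = det(I + yB + zC)`.
[cite: LewisParriloRamana2005, Prop. 3 and §3 (proof that Conjecture 2 implies Theorem 4)]
[cite: HeltonVinnikov2006, Thm. 2.2] -/
theorem realZero_det_of_laxConjecture (h : LewisParriloRamana2005_laxConjecture) :
    ∀ (d : ℕ) (q : MvPolynomial (Fin 2) ℝ),
      (∀ v : Fin 2 → ℝ, Multiset.card (MvPolynomial.aeval (fun i => C (v i) * X) q).roots =
        (MvPolynomial.aeval (fun i => C (v i) * X) q).natDegree) →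
      q.totalDegree = d → MvPolynomial.eval ![0, 0] q = 1 →
      ∃ B C : Matrix (Fin d) (Fin d) ℝ, B.IsSymm ∧ C.IsSymm ∧
        ∀ y z : ℝ, MvPolynomial.eval ![y, z] q =
          ((1 : Matrix (Fin d) (Fin d) ℝ) + y • B + z • C).det := by
  intro d q hRZ hdeg hq0
  classical
  -- Prop. 3, second half: the homogenisation `p(x,y,z) = x^d q(y/x, z/x)` …
  set p : MvPolynomial (Fin 3) ℝ := ∑ m ∈ q.support, MvPolynomial.monomial
    (Finsupp.single 0 (d - (m 0 + m 1)) + Finsupp.single 1 (m 0) + Finsupp.single 2 (m 1))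
    (q.coeff m) with hpdef
  have hmdeg : ∀ m ∈ q.support, m 0 + m 1 ≤ d := by
    intro m hm
    have hle := MvPolynomial.le_totalDegree hm
    rw [Finsupp.sum_fintype _ _ (by simp), Fin.sum_univ_two, hdeg] at hle
    exact hle
  -- … is a form of degree `d` …
  have hhom : p.IsHomogeneous d := by
    refine MvPolynomial.IsHomogeneous.sum _ _ _ fun m hm => ?_
    refine MvPolynomial.isHomogeneous_monomial _ ?_
    simp only [map_add, Finsupp.degree_single]
    have := hmdeg m hm
    omega
  have hpeval : ∀ x y z : ℝ, MvPolynomial.eval ![x, y, z] p =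
      ∑ m ∈ q.support, q.coeff m * (x ^ (d - (m 0 + m 1)) * y ^ (m 0) * z ^ (m 1)) := by
    intro x y z
    rw [hpdef, map_sum]
    refine sum_congr rfl fun m _ => ?_
    rw [MvPolynomial.eval_monomial, Finsupp.prod_add_index' (by simp) (by simp [pow_add]),
      Finsupp.prod_add_index' (by simp) (by simp [pow_add]), Finsupp.prod_single_index (by simp),
      Finsupp.prod_single_index (by simp), Finsupp.prod_single_index (by simp)]
    simp
  have hqsum : ∀ y z : ℝ, MvPolynomial.eval ![y, z] q =
      ∑ m ∈ q.support, q.coeff m * (y ^ (m 0) * z ^ (m 1)) := by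
    intro y z
    rw [MvPolynomial.eval_eq']
    refine sum_congr rfl fun m _ => ?_
    rw [Fin.prod_univ_two]
    simp
  -- … with `p(1,y,z) = q(y,z)`, in particular `p(1,0,0) = q(0,0) = 1` …
  have hp1 : ∀ y z : ℝ, MvPolynomial.eval ![1, y, z] p = MvPolynomial.eval ![y, z] q := by
    intro y z
    rw [hpeval, hqsum]
    simp
  have hpe : MvPolynomial.eval ![1, 0, 0] p = 1 := by rw [hp1]; exact hq0
  -- … and hyperbolic with respect to `e = (1,0,0)`
  have hhyp : ∀ w : Fin 3 → ℝ, Multiset.card (MvPolynomial.aeval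
      (fun i => Polynomial.C (w i) - Polynomial.C ((![1, 0, 0] : Fin 3 → ℝ) i) * Polynomial.X)
      p).roots = d := by
    intro w
    set hw := MvPolynomial.aeval
      (fun i => Polynomial.C (w i) - Polynomial.C ((![1, 0, 0] : Fin 3 → ℝ) i) * Polynomial.X) p
      with hhwdef
    set Q := MvPolynomial.aeval (fun i => C ((![w 1, w 2] : Fin 2 → ℝ) i) * X) q with hQdef
    have hQdeg : Q.natDegree ≤ d := (natDegree_aeval_C_mul_X_le _ q).trans hdeg.le
    have hQsplit : Q.Splits := splits_iff_card_roots.mpr (hRZ ![w 1, w 2])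
    have hQeval : ∀ t, Q.eval t = MvPolynomial.eval ![w 1 * t, w 2 * t] q := by
      intro t
      have hfun : (fun i => (C ((![w 1, w 2] : Fin 2 → ℝ) i) * X).eval t) = ![w 1 * t, w 2 * t] := by
        funext i
        fin_cases i <;> simp
      rw [hQdef, FieldTheory.QuasiAlgClosed.eval_aeval_eq_eval, hfun]
    have hQ0 : Q.coeff 0 = 1 := by
      rw [coeff_zero_eq_eval_zero, hQeval]
      simpa using hq0
    -- `t ↦ p(w − te)` is the reflection of `Q`, composed with `s = w₀ − t`
    set R := (Q.reflect d).comp (C (w 0) - X) with hRdef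
    have hRdegQ : (Q.reflect d).natDegree = d := by
      refine le_antisymm (natDegree_reflect_le.trans (max_le le_rfl hQdeg))
        (le_natDegree_of_ne_zero ?_)
      rw [coeff_reflect, revAt_le le_rfl, Nat.sub_self, hQ0]
      exact one_ne_zero
    have hlin : (C (w 0) - X : ℝ[X]).natDegree = 1 := by
      rw [show (C (w 0) - X : ℝ[X]) = -(X - C (w 0)) by ring, natDegree_neg, natDegree_X_sub_C]
    have hRdeg : R.natDegree = d := by
      rw [hRdef, natDegree_comp, hRdegQ, hlin, mul_one]
    have hRsplit : R.Splits :=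
      (splits_reflect hQsplit d hQdeg).comp_of_natDegree_le_one hlin.le
    have hReval : ∀ t, t ≠ w 0 → R.eval t = MvPolynomial.eval ![w 0 - t, w 1, w 2] p := by
      intro t ht
      have hs : w 0 - t ≠ 0 := sub_ne_zero.mpr (Ne.symm ht)
      rw [hRdef, eval_comp, eval_sub, eval_C, eval_X, eval_reflect_of_ne_zero hQdeg hs, hQeval,
        ← hp1]
      have h1 : (![w 0 - t, w 1, w 2] : Fin 3 → ℝ) =
          (w 0 - t) • ![1, w 1 * (w 0 - t)⁻¹, w 2 * (w 0 - t)⁻¹] := by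
        have hx1 : (w 0 - t) * (w 1 * (w 0 - t)⁻¹) = w 1 := by field_simp
        have hx2 : (w 0 - t) * (w 2 * (w 0 - t)⁻¹) = w 2 := by field_simp
        funext i
        fin_cases i
        · simp
        · simpa using hx1.symm
        · simpa using hx2.symm
      rw [h1, hhom.eval_smul_eq]
    have hhweval : ∀ t, hw.eval t = MvPolynomial.eval ![w 0 - t, w 1, w 2] p := by
      intro t
      have hfun : (fun i => (Polynomial.C (w i) -
          Polynomial.C ((![1, 0, 0] : Fin 3 → ℝ) i) * Polynomial.X).eval t) = ![w 0 - t, w 1, w 2] := by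
        funext i
        fin_cases i <;> simp
      rw [hhwdef, FieldTheory.QuasiAlgClosed.eval_aeval_eq_eval, hfun]
    have hhwR : hw = R := by
      apply Polynomial.eq_of_infinite_eval_eq
      apply Set.Infinite.mono (s := {t : ℝ | t ≠ w 0})
      · intro t ht
        simp only [Set.mem_setOf_eq] at ht ⊢
        rw [hhweval, hReval t ht]
      · exact (Set.finite_singleton (w 0)).infinite_compl
    rw [hhwR, ← hRdeg]
    exact splits_iff_card_roots.mp hRsplit
  -- the Lax conjecture for `p`, read at `x = 1`
  obtain ⟨B, C, hB, hC, hdet⟩ := h d p hhom hpe hhyp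
  refine ⟨B, C, hB, hC, fun y z => ?_⟩
  rw [← hp1, hdet 1 y z, one_smul]

/-! ### The "if" direction of Conjecture 2 -/

/-- **The "if" direction of the Lax conjecture** (LPR2005, Conjecture 2: "The converse direction
in the Lax conjecture is immediate"; cf. Prop. 1, "any nonempty semidefinite slice is a
hyperbolicity cone"): for real symmetric `d × d` matrices `B, C`, the function
`(x,y,z) ↦ det(xI + yB + zC)` is (given by) a form `p` of degree `d` with `p(1,0,0) = 1` which is
hyperbolic with respect to `e = (1,0,0)` in the rendering of `LewisParriloRamana2005_laxConjecture`
(`t ↦ p(w − te) = (−1)^d det(tI − (w₀I + w₁B + w₂C))` has `d` real roots: the eigenvalues of a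
real symmetric matrix). [cite: LewisParriloRamana2005, Conjecture 2 ("if") and Prop. 1] -/
theorem det_pencil_hyperbolic {d : ℕ} (B C : Matrix (Fin d) (Fin d) ℝ) (hB : B.IsSymm)
    (hC : C.IsSymm) :
    ∃ p : MvPolynomial (Fin 3) ℝ, p.IsHomogeneous d ∧ MvPolynomial.eval ![1, 0, 0] p = 1 ∧
      (∀ w : Fin 3 → ℝ, Multiset.card (MvPolynomial.aeval
        (fun i => Polynomial.C (w i) - Polynomial.C ((![1, 0, 0] : Fin 3 → ℝ) i) * Polynomial.X)
        p).roots = d) ∧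
      ∀ x y z : ℝ, MvPolynomial.eval ![x, y, z] p =
        (x • (1 : Matrix (Fin d) (Fin d) ℝ) + y • B + z • C).det := by
  classical
  -- the pencil `xI + yB + zC` with entries in `ℝ[x,y,z]`
  set N : Matrix (Fin d) (Fin d) (MvPolynomial (Fin 3) ℝ) :=
    (MvPolynomial.X 0 : MvPolynomial (Fin 3) ℝ) • (1 : Matrix (Fin d) (Fin d) (MvPolynomial (Fin 3) ℝ)) +
      (MvPolynomial.X 1 : MvPolynomial (Fin 3) ℝ) • B.map (MvPolynomial.C : ℝ →+* MvPolynomial (Fin 3) ℝ) +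
      (MvPolynomial.X 2 : MvPolynomial (Fin 3) ℝ) • C.map (MvPolynomial.C : ℝ →+* MvPolynomial (Fin 3) ℝ)
    with hN
  have hNij : ∀ i j, N i j = (MvPolynomial.X 0 : MvPolynomial (Fin 3) ℝ) * (if i = j then 1 else 0) +
      MvPolynomial.X 1 * MvPolynomial.C (B i j) + MvPolynomial.X 2 * MvPolynomial.C (C i j) := by
    intro i j
    simp [hN, Matrix.add_apply, Matrix.smul_apply, Matrix.map_apply, Matrix.one_apply, smul_eq_mul]
  have heval : ∀ v : Fin 3 → ℝ, MvPolynomial.eval v N.det =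
      (v 0 • (1 : Matrix (Fin d) (Fin d) ℝ) + v 1 • B + v 2 • C).det := by
    intro v
    rw [RingHom.map_det]
    congr 1
    ext i j
    rw [RingHom.mapMatrix_apply, Matrix.map_apply, hNij]
    simp only [map_add, map_mul, MvPolynomial.eval_X, MvPolynomial.eval_C, Matrix.add_apply,
      Matrix.smul_apply, Matrix.one_apply, smul_eq_mul]
    split_ifs <;> simp
  refine ⟨N.det, ?_, ?_, ?_, ?_⟩
  · -- a form of degree `d`
    rw [Matrix.det_apply]
    refine MvPolynomial.IsHomogeneous.sum _ _ _ fun σ _ => ?_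
    have hentry : ∀ i j, (N i j).IsHomogeneous 1 := by
      intro i j
      rw [hNij]
      refine (((MvPolynomial.isHomogeneous_X ℝ (0 : Fin 3)).mul ?_).add
        ((MvPolynomial.isHomogeneous_X ℝ (1 : Fin 3)).mul (MvPolynomial.isHomogeneous_C _ _))).add
        ((MvPolynomial.isHomogeneous_X ℝ (2 : Fin 3)).mul (MvPolynomial.isHomogeneous_C _ _))
      split_ifs
      · exact MvPolynomial.isHomogeneous_one _ _
      · exact MvPolynomial.isHomogeneous_zero _ _ _
    have hprod : (∏ i, N (σ i) i).IsHomogeneous d := by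
      have := MvPolynomial.IsHomogeneous.prod Finset.univ (fun i => N (σ i) i) (fun _ => 1)
        fun i _ => hentry (σ i) i
      simpa [Finset.sum_const, Finset.card_univ] using this
    rcases Int.units_eq_one_or (Equiv.Perm.sign σ) with hσ | hσ
    · rw [hσ, one_smul]
      exact hprod
    · rw [hσ, Units.neg_smul, one_smul]
      exact hprod.neg
  · -- normalised at `e`
    rw [heval]
    simp
  · -- hyperbolic with respect to `e`: `p(w - te) = (-1)^d det(tI - M)`, `M = w₀I + w₁B + w₂C`
    intro w
    set g : Fin 3 → ℝ[X] :=
      fun i => Polynomial.C (w i) - Polynomial.C ((![1, 0, 0] : Fin 3 → ℝ) i) * Polynomial.X with hg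
    set M : Matrix (Fin d) (Fin d) ℝ := w 0 • (1 : Matrix (Fin d) (Fin d) ℝ) + w 1 • B + w 2 • C
      with hM
    have hMsymm : M.IsSymm := by
      rw [hM]
      exact ((Matrix.isSymm_one.smul _).add (hB.smul _)).add (hC.smul _)
    have hMherm : M.IsHermitian := by
      change Mᴴ = M
      rw [conjTranspose_eq_transpose_of_trivial]
      exact hMsymm
    have hmat : (MvPolynomial.aeval g).toRingHom.mapMatrix N = -charmatrix M := by
      ext i j
      rw [RingHom.mapMatrix_apply, Matrix.map_apply, hNij, Matrix.neg_apply, charmatrix_apply,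
        Matrix.diagonal_apply]
      simp only [hg, hM, map_add, map_mul, Matrix.add_apply, Matrix.smul_apply, Matrix.one_apply,
        smul_eq_mul]
      split_ifs <;> first | (simp; done) | (simp; ring)
    have hdet : MvPolynomial.aeval g N.det = Polynomial.C ((-1 : ℝ) ^ d) * M.charpoly := by
      rw [show MvPolynomial.aeval g N.det = (MvPolynomial.aeval g).toRingHom N.det from rfl,
        RingHom.map_det, hmat, det_neg, Fintype.card_fin, Matrix.charpoly, map_pow, map_neg, map_one]
    change Multiset.card (MvPolynomial.aeval g N.det).roots = d
    rw [hdet, roots_C_mul _ (pow_ne_zero _ (neg_ne_zero.mpr one_ne_zero)),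
      splits_iff_card_roots.mp hMherm.splits_charpoly, charpoly_natDegree_eq_dim, Fintype.card_fin]
  · intro x y z
    rw [heval]
    simp

/-- **Lewis–Parrilo–Ramana 2005, §3: "We claim that Theorem 4 is equivalent to the Lax
conjecture."** The named fact `LewisParriloRamana2005_laxConjecture` (Conjecture 2, only-if
direction, normalised at `e = (1,0,0)`) is equivalent to Theorem 4 (= Helton–Vinnikov 2007,
Thm. 2.2 for `m = 2`, only-if direction) in the rendering of `laxConjecture_of_realZero_det`.
[cite: LewisParriloRamana2005, §3] -/
theorem laxConjecture_iff_realZero_det :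
    LewisParriloRamana2005_laxConjecture ↔
      ∀ (d : ℕ) (q : MvPolynomial (Fin 2) ℝ),
        (∀ v : Fin 2 → ℝ, Multiset.card (MvPolynomial.aeval (fun i => C (v i) * X) q).roots =
          (MvPolynomial.aeval (fun i => C (v i) * X) q).natDegree) →
        q.totalDegree = d → MvPolynomial.eval ![0, 0] q = 1 →
        ∃ B C : Matrix (Fin d) (Fin d) ℝ, B.IsSymm ∧ C.IsSymm ∧
          ∀ y z : ℝ, MvPolynomial.eval ![y, z] q =
            ((1 : Matrix (Fin d) (Fin d) ℝ) + y • B + z • C).det :=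
  ⟨realZero_det_of_laxConjecture, laxConjecture_of_realZero_det⟩

/-! ### Hanselka's Theorem 2 for a general direction `e` (linear change of variables) -/

/-- A non-zero vector of `ℝ³` is the first column of an invertible matrix. [folklore] -/
theorem exists_matrix_mulVec_eq (e : Fin 3 → ℝ) (he : e ≠ 0) :
    ∃ T : Matrix (Fin 3) (Fin 3) ℝ, IsUnit T.det ∧ T *ᵥ ![1, 0, 0] = e := by
  have hmul : ∀ T : Matrix (Fin 3) (Fin 3) ℝ, T *ᵥ ![1, 0, 0] = fun i => T i 0 := by
    intro T
    funext i
    simp [Matrix.mulVec, dotProduct, Fin.sum_univ_three]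
  by_cases h0 : e 0 ≠ 0
  · refine ⟨!![e 0, 0, 0; e 1, 1, 0; e 2, 0, 1], ?_, ?_⟩
    · rw [isUnit_iff_ne_zero, Matrix.det_fin_three]
      simpa using h0
    · rw [hmul]
      funext i
      fin_cases i <;> simp
  · push Not at h0
    by_cases h1 : e 1 ≠ 0
    · refine ⟨!![e 0, 1, 0; e 1, 0, 0; e 2, 0, 1], ?_, ?_⟩
      · rw [isUnit_iff_ne_zero, Matrix.det_fin_three]
        simpa using h1
      · rw [hmul]
        funext i
        fin_cases i <;> simp
    · push Not at h1
      have h2 : e 2 ≠ 0 := by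
        intro h2
        apply he
        funext i
        fin_cases i <;> simp [h0, h1, h2]
      refine ⟨!![e 0, 1, 0; e 1, 0, 1; e 2, 0, 0], ?_, ?_⟩
      · rw [isUnit_iff_ne_zero, Matrix.det_fin_three]
        simpa using h2
      · rw [hmul]
        funext i
        fin_cases i <;> simp

/-- Evaluation of a linear pull-back `F ∘ T`. [folklore] -/
theorem eval_aeval_linear (T : Matrix (Fin 3) (Fin 3) ℝ) (F : MvPolynomial (Fin 3) ℝ)
    (y : Fin 3 → ℝ) :
    MvPolynomial.eval y (MvPolynomial.aeval
      (fun i => ∑ k : Fin 3, MvPolynomial.C (T i k) * MvPolynomial.X k) F) =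
      MvPolynomial.eval (T *ᵥ y) F := by
  have hfun : (fun i => MvPolynomial.eval y (∑ k : Fin 3, MvPolynomial.C (T i k) * MvPolynomial.X k)) =
      T *ᵥ y := by
    funext i
    simp [map_sum, Matrix.mulVec, dotProduct]
  rw [eval_aeval_mvPolynomial, hfun]

/-- **Hanselka 2017, Thm. 2 (= Helton–Vinnikov) for a general direction, from the named fact**
(normalised form, valid in every degree): if the ternary form `F` of degree `d` is hyperbolic
with respect to `e ∈ ℝ³` with `F(e) > 0` — i.e. `t ↦ F(w − te)` has `d` real roots for every `w`
— then there are real symmetric `d × d` matrices `A₀, A₁, A₂` with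
`e₀A₀ + e₁A₁ + e₂A₂ = I` and `F(v) = F(e) · det(v₀A₀ + v₁A₁ + v₂A₂)` for all `v`. (Reduction as
printed, ibid. proof of Thm. 2: "after rescaling `F` and `e` and applying a linear change of
variables we can assume that `F(e) = 1` and `e = (0,0,1)`" — here `e = (1,0,0)`, the
normalisation of `LewisParriloRamana2005_laxConjecture`.)
[cite: Hanselka2017, Thm. 2 and its proof (§6)] [cite: LewisParriloRamana2005, Conjecture 2] -/
theorem symmetric_pencil_of_laxConjecture (h : LewisParriloRamana2005_laxConjecture) {d : ℕ}
    {F : MvPolynomial (Fin 3) ℝ} (hF : F.IsHomogeneous d) {e : Fin 3 → ℝ}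
    (he : 0 < MvPolynomial.eval e F)
    (hhyp : ∀ w : Fin 3 → ℝ, Multiset.card (MvPolynomial.aeval
      (fun i => Polynomial.C (w i) - Polynomial.C (e i) * Polynomial.X) F).roots = d) :
    ∃ A₀ A₁ A₂ : Matrix (Fin d) (Fin d) ℝ, A₀.IsSymm ∧ A₁.IsSymm ∧ A₂.IsSymm ∧
      e 0 • A₀ + e 1 • A₁ + e 2 • A₂ = 1 ∧
      ∀ v : Fin 3 → ℝ, MvPolynomial.eval v F =
        MvPolynomial.eval e F * (v 0 • A₀ + v 1 • A₁ + v 2 • A₂).det := by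
  classical
  -- the degenerate case `e = 0` forces `d = 0`
  by_cases he0 : e = 0
  · have hd : d = 0 := by
      by_contra hd
      have hzero : MvPolynomial.eval e F = 0 := by
        rw [he0, show (0 : Fin 3 → ℝ) = (0 : ℝ) • (0 : Fin 3 → ℝ) by simp, hF.eval_smul_eq,
          zero_pow hd, zero_mul]
      exact he.ne' hzero
    subst hd
    refine ⟨1, 1, 1, Matrix.isSymm_one, Matrix.isSymm_one, Matrix.isSymm_one,
      Subsingleton.elim _ _, fun v => ?_⟩
    rw [Matrix.det_isEmpty, mul_one]
    -- a form of degree `0` is constant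
    have hv : MvPolynomial.eval v F = MvPolynomial.eval ((0 : ℝ) • v) F := by
      rw [hF.eval_smul_eq, pow_zero, one_mul]
    have he' : MvPolynomial.eval e F = MvPolynomial.eval ((0 : ℝ) • e) F := by
      rw [hF.eval_smul_eq, pow_zero, one_mul]
    rw [hv, he', zero_smul, zero_smul]
  set c : ℝ := MvPolynomial.eval e F with hc
  have hc0 : c ≠ 0 := he.ne'
  -- an invertible `T` with `T e₁ = e`, and the pull-back `p = F ∘ T`
  obtain ⟨T, hTunit, hTe⟩ := exists_matrix_mulVec_eq e he0
  set ψ : Fin 3 → MvPolynomial (Fin 3) ℝ :=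
    fun i => ∑ k : Fin 3, MvPolynomial.C (T i k) * MvPolynomial.X k with hψ
  set p : MvPolynomial (Fin 3) ℝ := MvPolynomial.C c⁻¹ * MvPolynomial.aeval ψ F with hp
  have hpeval : ∀ y, MvPolynomial.eval y p = c⁻¹ * MvPolynomial.eval (T *ᵥ y) F := by
    intro y
    rw [hp, map_mul, MvPolynomial.eval_C, hψ, eval_aeval_linear]
  have hphom : p.IsHomogeneous d := by
    have h1 : (MvPolynomial.aeval ψ F).IsHomogeneous (1 * d) := by
      refine hF.aeval ψ fun i => ?_
      refine MvPolynomial.IsHomogeneous.sum _ _ _ fun k _ => ?_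
      exact (MvPolynomial.isHomogeneous_X ℝ k).C_mul _
    rw [one_mul] at h1
    exact h1.C_mul _
  have hpe : MvPolynomial.eval ![1, 0, 0] p = 1 := by
    rw [hpeval, hTe, ← hc, inv_mul_cancel₀ hc0]
  have hphyp : ∀ w : Fin 3 → ℝ, Multiset.card (MvPolynomial.aeval
      (fun i => Polynomial.C (w i) - Polynomial.C ((![1, 0, 0] : Fin 3 → ℝ) i) * Polynomial.X)
      p).roots = d := by
    intro w
    have hpoly : MvPolynomial.aeval
        (fun i => Polynomial.C (w i) - Polynomial.C ((![1, 0, 0] : Fin 3 → ℝ) i) * Polynomial.X) p =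
        Polynomial.C c⁻¹ * MvPolynomial.aeval
          (fun i => Polynomial.C ((T *ᵥ w) i) - Polynomial.C (e i) * Polynomial.X) F := by
      refine Polynomial.funext fun t => ?_
      rw [FieldTheory.QuasiAlgClosed.eval_aeval_eq_eval, Polynomial.eval_mul, Polynomial.eval_C,
        FieldTheory.QuasiAlgClosed.eval_aeval_eq_eval, hpeval]
      congr 2
      have h1 : (fun i => (Polynomial.C (w i) -
          Polynomial.C ((![1, 0, 0] : Fin 3 → ℝ) i) * Polynomial.X).eval t) = w - t • ![1, 0, 0] := by
        funext i
        simp only [Polynomial.eval_sub, Polynomial.eval_mul, Polynomial.eval_C, Polynomial.eval_X,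
          Pi.sub_apply, Pi.smul_apply, smul_eq_mul]
        ring
      have h2 : (fun i => (Polynomial.C ((T *ᵥ w) i) - Polynomial.C (e i) * Polynomial.X).eval t) =
          T *ᵥ w - t • e := by
        funext i
        simp only [Polynomial.eval_sub, Polynomial.eval_mul, Polynomial.eval_C, Polynomial.eval_X,
          Pi.sub_apply, Pi.smul_apply, smul_eq_mul]
        ring
      rw [h1, h2, Matrix.mulVec_sub, Matrix.mulVec_smul, hTe]
    rw [hpoly, Polynomial.roots_C_mul _ (inv_ne_zero hc0)]
    exact hhyp (T *ᵥ w)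
  -- the named fact for `p`
  obtain ⟨B, C, hB, hC, hdet⟩ := h d p hphom hpe hphyp
  have hdet' : ∀ u : Fin 3 → ℝ, MvPolynomial.eval u p =
      (u 0 • (1 : Matrix (Fin d) (Fin d) ℝ) + u 1 • B + u 2 • C).det := by
    intro u
    have hu : u = ![u 0, u 1, u 2] := by
      funext i
      fin_cases i <;> rfl
    conv_lhs => rw [hu]
    exact hdet (u 0) (u 1) (u 2)
  -- back to the original coordinates with `S = T⁻¹`
  set S : Matrix (Fin 3) (Fin 3) ℝ := T⁻¹ with hS
  have hTS : T * S = 1 := Matrix.mul_nonsing_inv T hTunit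
  have hST : S * T = 1 := Matrix.nonsing_inv_mul T hTunit
  set A : Fin 3 → Matrix (Fin d) (Fin d) ℝ :=
    fun k => S 0 k • (1 : Matrix (Fin d) (Fin d) ℝ) + S 1 k • B + S 2 k • C with hA
  have hAsymm : ∀ k, (A k).IsSymm := fun k =>
    ((Matrix.isSymm_one.smul _).add (hB.smul _)).add (hC.smul _)
  have hpencil : ∀ v : Fin 3 → ℝ, v 0 • A 0 + v 1 • A 1 + v 2 • A 2 =
      (S *ᵥ v) 0 • (1 : Matrix (Fin d) (Fin d) ℝ) + (S *ᵥ v) 1 • B + (S *ᵥ v) 2 • C := by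
    intro v
    simp only [hA, Matrix.mulVec, dotProduct, Fin.sum_univ_three]
    module
  refine ⟨A 0, A 1, A 2, hAsymm 0, hAsymm 1, hAsymm 2, ?_, fun v => ?_⟩
  · -- `L(e) = I` since `S e = e₁`
    have hSe : S *ᵥ e = ![1, 0, 0] := by
      rw [← hTe, Matrix.mulVec_mulVec, hST, Matrix.one_mulVec]
    rw [hpencil, hSe]
    simp
  · -- `F(v) = F(T (S v)) = c · p(S v) = c · det L(v)`
    have hv : T *ᵥ (S *ᵥ v) = v := by
      rw [Matrix.mulVec_mulVec, hTS, Matrix.one_mulVec]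
    have h1 : MvPolynomial.eval v F = c * MvPolynomial.eval (S *ᵥ v) p := by
      rw [hpeval, hv, ← mul_assoc, mul_inv_cancel₀ hc0, one_mul]
    rw [h1, hdet', hpencil]

/-- **Hanselka 2017, Thm. 2 as printed** ("Let `F ∈ ℝ[x,y,z]` be hyperbolic with respect to
`e ∈ ℝ³`. Then there exists a real symmetric matrix pencil `L = A x + B y + C z`
(`A, B, C ∈ Sym_n ℝ`) such that `L(e)` is positive definite and `F = det L`"; hyperbolic means
`F(e) > 0` and all `t ↦ F(te − a)` real-rooted, ibid. §"Application to Hyperbolic Polynomials"),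
for forms of positive degree `d` (for `d = 0` the printed statement needs `F = 1`), derived from
the named fact `LewisParriloRamana2005_laxConjecture`: absorb `F(e)^{1/d}` into the pencil of
`symmetric_pencil_of_laxConjecture`. [cite: Hanselka2017, Thm. 2] -/
theorem heltonVinnikov_of_laxConjecture (h : LewisParriloRamana2005_laxConjecture) {d : ℕ}
    (hd : 0 < d) {F : MvPolynomial (Fin 3) ℝ} (hF : F.IsHomogeneous d) {e : Fin 3 → ℝ}
    (he : 0 < MvPolynomial.eval e F)
    (hhyp : ∀ w : Fin 3 → ℝ, Multiset.card (MvPolynomial.aeval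
      (fun i => Polynomial.C (w i) - Polynomial.C (e i) * Polynomial.X) F).roots = d) :
    ∃ A₀ A₁ A₂ : Matrix (Fin d) (Fin d) ℝ, A₀.IsSymm ∧ A₁.IsSymm ∧ A₂.IsSymm ∧
      (e 0 • A₀ + e 1 • A₁ + e 2 • A₂).PosDef ∧
      ∀ v : Fin 3 → ℝ, MvPolynomial.eval v F = (v 0 • A₀ + v 1 • A₁ + v 2 • A₂).det := by
  obtain ⟨A₀, A₁, A₂, h₀, h₁, h₂, hI, hdet⟩ := symmetric_pencil_of_laxConjecture h hF he hhyp
  set c : ℝ := MvPolynomial.eval e F with hc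
  set a : ℝ := c ^ ((d : ℝ)⁻¹) with ha
  have ha0 : 0 < a := Real.rpow_pos_of_pos he _
  have had : a ^ d = c := by
    rw [ha, ← Real.rpow_natCast, ← Real.rpow_mul he.le, inv_mul_cancel₀ (by exact_mod_cast hd.ne'),
      Real.rpow_one]
  refine ⟨a • A₀, a • A₁, a • A₂, h₀.smul _, h₁.smul _, h₂.smul _, ?_, fun v => ?_⟩
  · have hL : e 0 • (a • A₀) + e 1 • (a • A₁) + e 2 • (a • A₂) = a • (1 : Matrix (Fin d) (Fin d) ℝ) := by
      rw [← hI, smul_add, smul_add, smul_comm (e 0), smul_comm (e 1), smul_comm (e 2)]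
    rw [hL]
    exact Matrix.PosDef.one.smul ha0
  · have hL : v 0 • (a • A₀) + v 1 • (a • A₁) + v 2 • (a • A₂) = a • (v 0 • A₀ + v 1 • A₁ + v 2 • A₂) := by
      rw [smul_add, smul_add, smul_comm (v 0), smul_comm (v 1), smul_comm (v 2)]
    rw [hL, det_smul, Fintype.card_fin, had, hdet v]

end Literature.AlgebraicGeometry.DeterminantalHypersurfaces
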